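import Literature.NumberTheory.EllipticCurves.Kato2004.IwasawaCohomologyCoeff
import Literature.NumberTheory.EllipticCurves.IwasawaAlgebra
import HarnessLib

/-!
# Kato 2004 (Astérisque 295) Thm. 12.4 (1), Thm. 12.5 (2), Thm. 12.6 and §12.10, with Burungale–Tian
# 2026 Thm. 2.6: the pair (`𝐇²(T)`, `Z ⊂ 𝐇¹(T)`) of Kato's Chapter III for a representation WITH
# COEFFICIENTS, as a hypothesis STRUCTURE on the pinned `𝐇¹_Γ(T)` (`Kato2004.ZetaQuotientPackage`),
# and the predicate "the two characteristic ideals agree in `Λ ⊗ ℚ`" on such a package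
# (`ZetaQuotientPackage.CharIdealEqUpToConst`) — VOCABULARY (definitions only; nothing asserted)

Topic `NumberTheory/EllipticCurves`, sub-directory `Kato2004` (namespace = path). Written by cell
`bsd-stepL`'s definition typer (seat `bsd-stepL-defn-ty1`, g23) as step (3) of serving the cite/fact
items **wi-88196** (Kato §12 Thm. 12.4/12.5/12.6 for a weight-`2` newform `g` with `𝒪_λ`-coefficients,
`p = 2` allowed) and **wi-88195** (Burungale–Tian 2026 Thm. 2.6 for CM `g`, "abstract-ends λ-form")
of cell `bsd-wall` (crux stmt-BirchSwinnertonDyer-26074 `ResidualThetaCountLowerPureAtTwo`, skeleton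
`Cruxes/ResidualThetaCountLowerPureAtTwo/Lines/bt26_lambda.lean`, research stub `stub_cmLambdaLower`
(S2), LEAD `bsd-wall-rtt-p2`). Steps (1)–(2) are `Kato2004/IwasawaCohomologyCoeff.lean` (the pinned
`𝐇¹_Γ(T)` over `A⟦X⟧`, `IwasawaH1DataCoeff`) and `Kato2004/IwasawaCohomologyCoeffNewform.lean` (the
named facts `nonempty_iwasawaH1DataCoeff_newform`, `thm12_4_newform`: (12.2.1) + Thm. 12.4 (2) for the
lattice of `g`, non-vacuous because `𝐇¹_Γ` is PINNED).

## Why the remaining printed statements are typed as VOCABULARY and not as a closed named fact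

Kato's Thm. 12.4 (1) ("`𝐇²(T)` is a torsion `Λ`-module"), Thm. 12.5 (2) ("`𝐇¹(V_{F_λ}(f))/Z(f)` is a
torsion `Λ ⊗ ℚ`-module"), Thm. 12.6 (the integral zeta elements lie in `𝐇¹(T)` and span `Z ⊂ Z(f,T)`
of finite index) and Burungale–Tian's Thm. 2.6 ("`ξ(𝐇²(V_{F_λ}(f))) = ξ(𝐇¹(V_{F_λ}(f))/Z(f))`, an
equality of ideals in `Λ ⊗ ℚ`", `f` CM, every `p`) are statements about TWO objects the tree does not
have: Kato's `𝐇²(T)` (no degree-`2` corestriction / Λ-adic étale `H²` in the tree — cf. the module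
docstrings of `Kato2004/DivisibilityInputs.lean` and `Kato2004/IwasawaH2Descent.lean`: "`𝐇²` … can only
enter as … ONE hypothesis STRUCTURE whose fields are the printed statements about it RELATIVE TO PINNED
OBJECTS") and the zeta submodule `Z(f)` (its characterising property, Kato 12.5 (1) = Burungale–Tian
Rem. 2.5, is written with the dual exponential map and the period module `S(f)` of `V_{F_λ}(f)`, absent
from the tree for a newform with coefficients). A CLOSED statement "there exist a finitely generated
torsion `Λ_𝒪`-module `H₂` and a submodule `Z ≤ 𝐇¹_Γ(T)` with torsion quotient such that
`char(H₂) = char(𝐇¹_Γ/Z)` up to non-zero constants" is TRIVIALLY inhabited (`H₂ = 0`, `Z = ⊤`), and stays so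
after adding Kato's descent pin (14.14.1) (`H₂ :=` the cokernel of `𝐇¹_Γ/X → H¹(ℤ[1/p], T)` with
`X = 0`, `Z := X^r · 𝐇¹_Γ`); so such a "fact" would assert nothing and is NOT vendored (D-0014 asks for
honest facts). For `T = T_pE` at an ORDINARY prime the tree's package `Kato2004.DivisibilityInputs` is
contentful because its further fields — the four-term sequence (17.13.1) to the PINNED Selmer dual
`X(E/ℚ_∞)` and `ι G = p^n · L_p(E)` with `G ∈ col(loc Z)` (16.6, 17.11) — are PRINTED; for the consumer
here (`g` CM of weight `2` at `p = 2` with `a₂(g) = 0`, transported plus condition) the corresponding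
ties (plus/minus Coleman map over `𝒪` at `2`, four-term sequence à la Kobayashi 2003 Thm. 7.3 / (7.21))
are the consumer's declared PORT — unprinted at `p = 2` (Kobayashi, Kim, Ponsinet, Hatley–Lei all take
`p` odd; the crux memo `BT26-ENDPOINT-cruxidea1-r1g4.md` §0 records the locators) — and therefore
belong to the crux's research stub, not to Literature.  What Literature CAN and here DOES supply is the
CURRENCY in which that stub is stated so that the printed clauses ride along BY CONSTRUCTION:

  `∃ K : Kato2004.ZetaQuotientPackage I, K.CharIdealEqUpToConst ∧ ⟨port clauses about K.H2, K.Z⟩`,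

every field of `K` and the predicate being a sentence of [Kato] / [BT26] about Kato's own pair
(`𝐇²_Γ(T_g)`, `Z_Γ(g)`), which inhabits it by the cited theorems (READING below).  Nothing in this file
is asserted; net debt `0`.

## The printed statements (K. Kato, Astérisque 295 (2004), `[p. N]` = printed page, store key
`paper:doi-10-24033-ast-639` PDF page `N − 115`, files p0105–p0107 re-read by this seat 2026-08-28;
A. Burungale–Y. Tian, Ann. of Math. 203 (2026), store key
`paper:burungale2025-rank-zero-p-converse-theorem-gross-zagier`, files p0003–p0005 re-read 2026-08-28)

* [Kato] **(12.2.1)** [p. 220] "`𝐇¹(T)` and `𝐇²(T)` are finitely generated `ℤ_p[[G_∞]]`-modules."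
* [Kato] **Thm. 12.4** [p. 221] "Take any `Gal(ℚ̄/ℚ)`-stable `O_λ`-lattice `T` of `V_{F_λ}`. Then: (1)
  `𝐇²(T)` is a torsion `Λ`-module. (2) `𝐇¹(T)` is a torsion free `Λ`-module, and `𝐇¹(T) ⊗ ℚ =
  𝐇¹(V_{F_λ}(f))` is a free `Λ ⊗ ℚ`-module of rank `1`."
* [Kato] **Thm. 12.5** [pp. 221–222] "(1) There exists a unique `F_λ`-linear map `V_{F_λ}(f) →
  𝐇¹(V_{F_λ}(f)); γ ↦ z_γ^{(p)}` having the following property [its `exp*`-values are the periods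
  of `L_{{p}}(f*, χ, r)`] … (2) Let `Z(f)` be the `Λ ⊗ ℚ`-submodule of `𝐇¹(V_{F_λ}(f))` generated by
  `z_γ^{(p)}` for all `γ ∈ V_{F_λ}(f)`. Then `𝐇¹(V_{F_λ}(f))/Z(f)` is a torsion `Λ ⊗ ℚ`-module."
* [Kato] **Thm. 12.6** [p. 222] "Let `T = V_{O_λ}(f)` (8.3). Let `Z` be the `Λ`-submodule of
  `𝐇¹(V_{O_λ}(f))` generated by the following elements … (1) `(_{c,d}z^{(p)}_{p^n}(f, k, j, a(A),
  prime(pA)))_{n≥1} ∈ 𝐇¹(T)` … (2) … `∈ 𝐇¹(T)` … Then `Z ⊂ Z(f,T)` and `Z(f,T)/Z` is a finite group."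
* [Kato] **§12.10** [p. 223], read by [Kob03] p. 10 and [BT26] §2.2.6 as "Kato's main [C]":
  `char 𝐇²(T) = char 𝐇¹(T)/Z(T)` (here only the SHAPE of this equality is used, as a predicate; the
  [C] itself is asserted nowhere in this file).
* [BT26] **§2.1.1** [p. 3] "For a (`… ⊗_ℤ ℚ`)-torsion module `N`, let `ξ(N)` be the characteristic
  ideal."  **§2.2.2–2.2.3** [p. 4] "`Λ = O_λ[[G_∞]]` … `Δ ≃ ℤ/(p−1)` if `p` odd, `ℤ/2` else … Let
  `T ⊂ V_{F_λ}(f)` be a `G_ℚ`-stable `O_λ`-lattice … `𝐇^q(T) = lim←_n H^q(ℤ[ζ_{p^n}, 1/p], T)` …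
  `𝐇^q(V_{F_λ}(f)) = 𝐇^q(T) ⊗ ℚ`."  **Thm. 2.3** (= [Kato, Thm. 12.4]), **Thm. 2.4** (= [Kato, Thm.
  12.5]: "(1) There exists a non-zero `F_λ`-linear map `V_{F_λ}(f) → 𝐇¹(V_{F_λ}(f)); γ ↦ z_γ(f)`. (2)
  … `𝐇¹(V_{F_λ}(f))/Z(f)` is a torsion `(Λ ⊗ ℚ)`-module."), **Rem. 2.5** (the characterising property
  via critical `L`-values is [Kato, Thm. 12.5 (1)]).  **Theorem 2.6** [p. 5] "Let `f ∈ S_k(Γ₁(N))` be a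
  CM newform and `p` a prime. Let `F` be the Hecke field and `λ` a prime above `p`. Let `V_{F_λ}(f)` be
  the associated Galois representation and `𝐇^q(V_{F_λ}(f))` the Iwasawa cohomology. Let
  `Z(f) ⊂ 𝐇¹(V_{F_λ}(f))` be the `(Λ ⊗ ℚ)`-submodule of Beilinson–Kato elements. Then
  `ξ(𝐇²(V_{F_λ}(f))) = ξ(𝐇¹(V_{F_λ}(f))/Z(f))`, an equality of ideals in `Λ ⊗ ℚ`."  **Rem. 2.7** "A finer
  analysis of [12, §15] is essential to relate the integral versions … near future" (the `μ`-part is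
  NOT printed).

## READING (what inhabits the structure / satisfies the predicate, sentence by sentence)

For `T = T_ρ`, `ρ : Γ_ℚ → GL₂(𝒪)` an integral `p`-adic model of a newform `g` along `ι`
(`𝒪 = padicCoeffIntegers (Set.range ι)`, `Λ_𝒪 = 𝒪⟦X⟧`), `I : IwasawaH1DataCoeff ρ.toGaloisRep p κ γ`
the pinned `𝐇¹_Γ(T_ρ)` along the cyclotomic `ℤ_p`-extension (READING (R1)–(R2) of
`IwasawaCohomologyCoeffNewform.lean`: the component of `ℚ_∞` of Kato's `𝐇¹(T)`, `p = 2` included):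
`H2 := 𝐇²_Γ(T_ρ)` (the same component of Kato's `𝐇²(T)`; finitely generated and torsion over `𝒪⟦X⟧`
by (12.2.1) / Thm. 12.4 (1), a direct factor resp. — at `p = 2` — a `Λ`-submodule-up-to-`2`-torsion
of a finitely generated torsion module over the finite extension `Λ ⊇ 𝒪⟦X⟧`); `Z :=` the
`𝒪⟦X⟧`-span of the `ℚ_∞`-components (`IwasawaH1DataCoeff.lift` of the norm-compatible projections) of
Kato's INTEGRAL zeta elements of Thm. 12.6 (1)(2) — a submodule of `𝐇¹_Γ(T_ρ)` by 12.6; the quotient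
`𝐇¹_Γ/Z` is `𝒪⟦X⟧`-torsion because `𝐇¹(V)/Z(f)` is `Λ ⊗ ℚ`-torsion (12.5 (2)), `Z(f,T)/Z` is finite
(12.6) and `Z(f) = Z(f,T) ⊗ ℚ`.  The predicate `CharIdealEqUpToConst`: for `A = 𝒪 = O_λ` (a
complete DVR, finite over `ℤ_p`, uniformiser `ϖ`, `p = ϖ^e·u`) one has `Λ ⊗ ℚ = 𝒪⟦X⟧[1/p] =
𝒪⟦X⟧[1/ϖ]`, and an equality of NON-ZERO ideals `(g₁) = (g₂)` of `𝒪⟦X⟧[1/ϖ]` (characteristic ideals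
of finitely generated torsion modules over the factorial ring `𝒪⟦X⟧` are non-zero principal) holds iff
`ϖ^a·(g₁) = ϖ^b·(g₂)` in `𝒪⟦X⟧` for some `a, b`, iff `c·(g₁) = d·(g₂)` for some NON-ZERO CONSTANTS
`c, d ∈ 𝒪` (every non-zero `c ∈ 𝒪` is `ϖ^k` times a unit) — the form used below, which needs no
chosen uniformiser.  CAVEAT (review of p635097): "up to powers of `p`" (`p^a·(g₁) = p^b·(g₂)`) is the
same condition ONLY when `e = 1` (e.g. `𝒪 = ℤ_p`, the case of the tree's accepted clause `(BT)` of
`BurungaleTian2026.thm26_etaKatoSequences_charIdeal_upToP_of_cm`); for ramified `𝒪` (e.g. Hecke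
field `ℚ(i)` at `p = 2`) it is STRICTLY STRONGER (it would force `μ(𝐇²) ≡ μ(𝐇¹/Z) mod e`, integral
information that [BT26] Rem. 2.7 says is not printed), so it is NOT used here.  By [BT26] Thm. 2.6
Kato's pair satisfies `CharIdealEqUpToConst` when `g` has CM (component of `ℚ_∞`: `2 ∈ (Λ ⊗ ℚ)ˣ`, so
an equality of ideals of `Λ ⊗ ℚ` is the conjunction of its `Δ`-components also at `p = 2`).

Scope / NOT here: no existence fact (see above), no `𝐇²_loc`, no 12.5 (3)(4) length inequalities, no
Coleman / dual-exponential vocabulary, no Selmer group; no `instance` beyond the structure-projection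
attributes, no notation.  BSD is not advanced by this file; nothing is claimed about any curve or form.

## References

* K. Kato, Astérisque 295 (2004): (12.2.1) (p. 220), Thm. 12.4–12.6 (pp. 221–222), §12.10 (p. 223),
  §13.8 (p. 228), §13.12 (pp. 231–233). [Kato2004Asterisque]
* A. Burungale, Y. Tian, Ann. of Math. 203 (2026): §2.1.1 (p. 3), §2.2.2–2.2.6, Thm. 2.3, 2.4, Rem. 2.5,
  **Thm. 2.6, Rem. 2.7** (pp. 4–5). [BurungaleTian2026]
* S. Kobayashi, Invent. Math. 152 (2003), §5 (Kato's main [C] read as `Char 𝐇² = Char 𝐇¹/Z`, p. 10)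
  and Thm. 7.3 / (7.21) (the four-term sequence the consumer ports). [Kobayashi2003]
* Tree: `Kato2004/IwasawaCohomologyCoeff.lean`, `Kato2004/IwasawaCohomologyCoeffNewform.lean`,
  `Kato2004/DivisibilityInputs.lean` and `Kato2004/IwasawaH2Descent.lean` (the abstract-`𝐇²` package
  idiom), `BurungaleTian2026/EtaSignedMainConjectureTensorQ.lean` (the `(BT)` clause shape),
  `IwasawaAlgebra.lean` (`Module.charIdeal`, `Module.lengthAt`).
-/

noncomputable section

open scoped NumberField
open Field IsDedekindDomain
open Literature.NumberTheory.GaloisRepresentations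
open Literature.NumberTheory.EllipticCurves Literature.NumberTheory.EllipticCurves.Kato2004

namespace Literature.NumberTheory.EllipticCurves.Kato2004

section Package

variable {A : Type} [CommRing A] [TopologicalSpace A] {M : Type} [AddCommGroup M] [Module A M]
  [TopologicalSpace M] [IsTopologicalAddGroup M] [ContinuousSMul A M]
  {T : GaloisRep ℚ A M} {p : ℕ} [Fact p.Prime] {κ : ZpExtension ℚ p} {γ : absoluteGaloisGroup ℚ}
  (I : IwasawaH1DataCoeff T p κ γ)

/-- **Kato's pair (`𝐇²_Γ(T)`, `Z_Γ ⊂ 𝐇¹_Γ(T)`) on the pinned Iwasawa cohomology `I : 𝐇¹_Γ(T)` of a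
representation `T` with coefficients `A` (`Λ_A = A⟦X⟧`) — hypothesis structure whose fields are the
value-free clauses of Kato's Thm. 12.4 (1) / (12.2.1), Thm. 12.5 (2) and Thm. 12.6; nothing asserted,
NO existence fact (a closed existence statement with these fields alone is trivially inhabited —
module docstring).**  Data: an abstract `A⟦X⟧`-module `H2` («`𝐇²_Γ(T)`», finitely generated and
torsion: "(12.2.1) … `𝐇²(T)` are finitely generated", "Thm. 12.4 (1) `𝐇²(T)` is a torsion
`Λ`-module") and a submodule `Z ≤ I.H` («the `Λ`-span of the integral zeta elements, Thm. 12.6 (1)(2)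
… `∈ 𝐇¹(T)`») with `I.H ⧸ Z` torsion ("Thm. 12.5 (2) … `𝐇¹(V_{F_λ}(f))/Z(f)` is a torsion `Λ ⊗ ℚ`-module"
with "12.6 … `Z(f,T)/Z` is a finite group").  The currency in which a consumer states Kato-type
main-[C] shapes and their ports for `T` with coefficients (`ZetaQuotientPackage.CharIdealEqUpToConst`).
[cite: Kato2004Asterisque, Thm. 12.4 (1) (p. 221), (12.2.1) (p. 220), Thm. 12.5 (2) and Thm. 12.6 (p. 222)] -/
structure ZetaQuotientPackage : Type 1 where
  /-- `H2 = 𝐇²_Γ(T)`, abstract. -/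
  H2 : Type
  /-- `𝐇²` is an abelian group. -/
  [addCommGroupH2 : AddCommGroup H2]
  /-- `𝐇²` is an `A⟦X⟧`-module. -/
  [moduleH2 : Module (PowerSeries A) H2]
  /-- (12.2.1): `𝐇²_Γ(T)` is a finitely generated `A⟦X⟧`-module. -/
  finite_H2 : Module.Finite (PowerSeries A) H2
  /-- Thm. 12.4 (1): `𝐇²_Γ(T)` is a torsion `A⟦X⟧`-module. -/
  isTorsion_H2 : Module.IsTorsion (PowerSeries A) H2
  /-- Thm. 12.6 (1)(2): the `A⟦X⟧`-span `Z ⊂ 𝐇¹_Γ(T)` of (the components along `κ` of) Kato's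
  integral zeta elements. -/
  Z : Submodule (PowerSeries A) I.H
  /-- Thm. 12.5 (2) with Thm. 12.6 and Thm. 12.4 (2): `𝐇¹_Γ(T) ⧸ Z` is a torsion `A⟦X⟧`-module. -/
  isTorsion_quotient : Module.IsTorsion (PowerSeries A) (I.H ⧸ Z)

attribute [instance] ZetaQuotientPackage.addCommGroupH2 ZetaQuotientPackage.moduleH2

namespace ZetaQuotientPackage

variable {I} (K : ZetaQuotientPackage I)

/-- The zeta quotient `𝐇¹_Γ(T) ⧸ Z` of a package (Kato 12.5 (2): a torsion module).
[cite: Kato2004Asterisque, Thm. 12.5 (2) (p. 222)] -/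
abbrev zetaQuotient : Type := I.H ⧸ K.Z

/-- Kato 12.5 (2) on a package, as a statement about `zetaQuotient`. [cite: Kato2004Asterisque, Thm. 12.5 (2) (p. 222)] -/
theorem isTorsion_zetaQuotient : Module.IsTorsion (PowerSeries A) K.zetaQuotient :=
  K.isTorsion_quotient

/-- The characteristic ideal `char_{A⟦X⟧} 𝐇²_Γ(T)` of a package ([BT26] §2.1.1 `ξ`; tree
`Module.charIdeal`). [cite: BurungaleTian2026, §2.1.1 (p. 3)] -/
abbrev charH2 : Ideal (PowerSeries A) := Module.charIdeal (PowerSeries A) K.H2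

/-- The characteristic ideal `char_{A⟦X⟧} (𝐇¹_Γ(T) ⧸ Z)` of a package ([BT26] §2.1.1 `ξ`).
[cite: BurungaleTian2026, §2.1.1 (p. 3)] -/
abbrev charZetaQuotient : Ideal (PowerSeries A) := Module.charIdeal (PowerSeries A) (I.H ⧸ K.Z)

/-- **"`ξ(𝐇²) = ξ(𝐇¹/Z)` as ideals of `Λ ⊗ ℚ`" on a package** — the SHAPE of Kato's §12.10 equality
after `⊗ ℚ`, written UP TO NON-ZERO CONSTANTS of `A`: `∃ c d ∈ A ∖ {0}, (c)·char(H2) = (d)·char(𝐇¹_Γ ⧸ Z)`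
in `A⟦X⟧` (`c, d` embedded by `PowerSeries.C`).  For `A = O_λ` a complete DVR finite over `ℤ_p` this is
exactly "equality of the two (non-zero, principal) ideals in `Λ ⊗ ℚ = O_λ⟦X⟧[1/p] = O_λ⟦X⟧[1/ϖ]`"
(module docstring READING; every non-zero constant is `ϖ^k·unit`); over `ℤ_p` (`e = 1`) it is the
"up to powers of `p`" clause `(BT)` of the tree's `BurungaleTian2026.thm26_etaKatoSequences_charIdeal_upToP_of_cm`,
but for RAMIFIED `O_λ` "up to powers of `p`" would be strictly stronger (a congruence of `μ`-invariants
mod `e`, not printed — [BT26] Rem. 2.7), hence the constants form.  Burungale–Tian 2026 Thm. 2.6 PROVES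
this shape for Kato's own pair (`𝐇²(T)`, `Z(f)`) when `f` is a CM newform, every prime `p` (`p = 2`
included; component by component, `2 ∈ (Λ ⊗ ℚ)ˣ`); the `μ`-part is Rem. 2.7, not printed.  A PREDICATE
on packages (nothing asserted).  Consumers state their research stub as
`∃ K, K.CharIdealEqUpToConst ∧ ⟨port⟩`.
[cite: BurungaleTian2026, Thm. 2.6 and Rem. 2.7 (p. 5), §2.1.1 (p. 3)]
[cite: Kato2004Asterisque, §12.10 (p. 223)] -/
structure CharIdealEqUpToConst : Prop where
  /-- `(c)·char(𝐇²) = (d)·char(𝐇¹_Γ ⧸ Z)` for some non-zero constants `c, d ∈ A`. -/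
  exists_const_mul_eq : ∃ c d : A, c ≠ 0 ∧ d ≠ 0 ∧
    Ideal.span {PowerSeries.C c} * K.charH2 = Ideal.span {PowerSeries.C d} * K.charZetaQuotient

/-- Unfolding `CharIdealEqUpToConst`. [cite: BurungaleTian2026, Thm. 2.6 (p. 5)] -/
theorem charIdealEqUpToConst_iff :
    K.CharIdealEqUpToConst ↔
      ∃ c d : A, c ≠ 0 ∧ d ≠ 0 ∧
        Ideal.span {PowerSeries.C c} * Module.charIdeal (PowerSeries A) K.H2 =
          Ideal.span {PowerSeries.C d} * Module.charIdeal (PowerSeries A) (I.H ⧸ K.Z) :=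
  ⟨fun h ↦ h.exists_const_mul_eq, fun h ↦ ⟨h⟩⟩

/-- The INTEGRAL shape (Kato §12.10 verbatim, `char 𝐇² = char 𝐇¹/Z`) implies the `⊗ ℚ` shape (take
`c = d = 1`; `A` non-trivial). [cite: Kato2004Asterisque, §12.10 (p. 223)] -/
theorem charIdealEqUpToConst_of_eq [Nontrivial A] (h : K.charH2 = K.charZetaQuotient) :
    K.CharIdealEqUpToConst :=
  ⟨⟨1, 1, one_ne_zero, one_ne_zero, by rw [h]⟩⟩

/-- Over `A = ℤ_p`-like coefficients with `e = 1` a "powers of `p`" identity gives the constants form: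
if `(p^a)·char(H2) = (p^b)·char(𝐇¹/Z)` with `(p : A) ≠ 0`, then `CharIdealEqUpToConst` holds
(`c = p^a`, `d = p^b`; `A` a domain).  The converse needs `e = 1` and is not stated.
[cite: BurungaleTian2026, Thm. 2.6 (p. 5)] -/
theorem charIdealEqUpToConst_of_pow_prime [IsDomain A] (hp : (p : A) ≠ 0) {a b : ℕ}
    (h : Ideal.span {(p : PowerSeries A) ^ a} * K.charH2 =
      Ideal.span {(p : PowerSeries A) ^ b} * K.charZetaQuotient) :
    K.CharIdealEqUpToConst := by
  refine ⟨⟨(p : A) ^ a, (p : A) ^ b, pow_ne_zero _ hp, pow_ne_zero _ hp, ?_⟩⟩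
  simpa only [map_pow, map_natCast] using h

end ZetaQuotientPackage

end Package

end Literature.NumberTheory.EllipticCurves.Kato2004

end
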